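import HarnessLib
import Summits.Langlands.Langlands.Theses.QuarterDeficit1951

/-!
# `QuarterFingerprintDeficit` (stmt-Langlands-15897) — Negative knowledge: non-vacuity, the parity
# regime, and the load-bearing nontriviality clause

Crux-disprover lemmas (cdisprove cycle 1, 2026-08-16) for the crux C1 =
`Summit.Langlands.Langlands.Theses.QuarterDeficit1951.QuarterFingerprintDeficit`: for every Dirichlet
character `χ mod 1951` of order `5` there is NO nonzero bounded `C²` cuspidal Maass eigenform `u` on
`(Γ₀(1951), χ)` with `|λ − 1/4| ≤ 1/100` carrying the projective icosahedral fingerprint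
`‖μ_p² χ̄(p) − φ‖ ≤ 1/100`, `φ ∈ {0,1,4,(3±√5)/2}`, at `p ≤ 13` (a computational bet whose negation
is a certified sighting of the Doud–Moore even icosahedral Maass forms — the open even case of strong
Artin; no kernel `¬`-theorem of C1 is expected, see the crux work file `Cruxes/…/Disproof.lean`).

* `exists_dirichletCharacter_orderOf_eq_five` — the `∀ χ` of C1 ranges over a NON-EMPTY set
  (`#DirichletCharacter ℂ 1951 = #(ℤ/1951)ˣ = 1950`, `5 ∣ 1950`, Cauchy): C1 is not vacuously true
  for want of characters.
* `apply_neg_one_eq_one_of_orderOf_eq_five` — order-5 characters mod 1951 are EVEN, so the automorphy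
  clause at `−I ∈ Γ₀(1951)` (`u z = χ(−1) u z`) is consistent;
  `eq_zero_of_automorphic_of_apply_neg_one` — for an ODD character that clause alone forces `u ≡ 0`,
  i.e. the analogue of C1 for odd nebentypus is vacuously true: the order-5 hypothesis is what keeps
  C1 a genuine census statement.
* `quarterFingerprintDeficit_false_without_nonzero` — drop the clause `∃ z, u z ≠ 0` from C1
  (everything else verbatim) and it is FALSE: `u = 0`, `λ = 1/4`, `μ_p = 0`, `φ_p = 0`. Any proof or
  certificate for C1 must therefore produce a quantitative LOWER bound separating window forms from
  `0` (in the census: the trace-formula count is of nonzero eigenfunctions; in a quasimode refutation: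
  the trial vector's norm must be certified away from `0` after projection).

No statement of the route is used or asserted positively. [folklore]
-/

set_option linter.dupNamespace false -- project-wide option (lakefile weak.linter.dupNamespace); `Summit.Langlands.Langlands` is the mandated namespace

noncomputable section

namespace Summit.Langlands.Langlands.Theorems.QuarterFingerprintDeficit.Negative

/-- **Order-5 Dirichlet characters mod 1951 exist** (`1951` is prime, `#(ℤ/1951)ˣ = 1950 = 2·3·5²·13`,
`ℂ` has enough roots of unity so `#MulChar = #units`, then Cauchy's theorem). [folklore] -/
theorem exists_dirichletCharacter_orderOf_eq_five : ∃ χ : DirichletCharacter ℂ 1951, orderOf χ = 5 := by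
  haveI : Fact (Nat.Prime 1951) := ⟨by norm_num⟩
  haveI : NeZero ((Monoid.exponent (ZMod 1951)ˣ : ℕ) : ℂ) :=
    ⟨by exact_mod_cast Monoid.exponent_ne_zero.mpr Monoid.ExponentExists.of_finite⟩
  have h1 : Nat.card (DirichletCharacter ℂ 1951) = 1950 := by
    rw [DirichletCharacter, MulChar.card_eq_card_units_of_hasEnoughRootsOfUnity (ZMod 1951) ℂ,
      Nat.card_eq_fintype_card, ZMod.card_units]
  haveI : Fact (Nat.Prime 5) := ⟨by norm_num⟩
  exact exists_prime_orderOf_dvd_card' (G := DirichletCharacter ℂ 1951) 5 (by rw [h1]; norm_num)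

/-- **Order-5 characters are even**: `χ(−1)² = 1` and `χ(−1)^5 = 1` give `χ(−1) = 1`. [folklore] -/
theorem apply_neg_one_eq_one_of_orderOf_eq_five (χ : DirichletCharacter ℂ 1951)
    (h : orderOf χ = 5) : χ (-1) = 1 := by
  have hsq : χ (-1) * χ (-1) = 1 := by rw [← map_mul, neg_one_mul, neg_neg, map_one]
  rcases mul_self_eq_one_iff.mp hsq with h1 | h1
  · exact h1
  · exfalso
    have h' : (χ (-1)) ^ orderOf χ = 1 := by
      have hu : IsUnit (-1 : ZMod 1951) := isUnit_one.neg
      obtain ⟨u, hu'⟩ := hu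
      have := congr_arg (fun φ : DirichletCharacter ℂ 1951 => φ (u : ZMod 1951))
        (pow_orderOf_eq_one χ)
      simp only [MulChar.pow_apply_coe, MulChar.one_apply_coe] at this
      rwa [hu'] at this
    rw [h1, h] at h'
    norm_num at h'

/-- **The parity regime C1 avoids.** If `χ(−1) = −1` then the crux's automorphy clause
`u (γ • z) = χ(d_γ) u z` on `Γ₀(1951)` alone forces `u ≡ 0`: take `γ = −I ∈ Γ₀(1951)`, which acts
trivially on `ℍ` and has `d = −1`. So "no nonzero form with odd nebentypus" is vacuously true, and
by `apply_neg_one_eq_one_of_orderOf_eq_five` the order-5 characters are exactly not in this regime. [folklore] -/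
theorem eq_zero_of_automorphic_of_apply_neg_one (χ : DirichletCharacter ℂ 1951) (hodd : χ (-1) = -1)
    (u : UpperHalfPlane → ℂ)
    (hu : ∀ γ : Matrix.SpecialLinearGroup (Fin 2) ℤ, γ ∈ CongruenceSubgroup.Gamma0 1951 →
      ∀ z : UpperHalfPlane, u (γ • z) = χ ((γ 1 1 : ℤ) : ZMod 1951) * u z) (z : UpperHalfPlane) :
    u z = 0 := by
  have hmem : (-1 : Matrix.SpecialLinearGroup (Fin 2) ℤ) ∈ CongruenceSubgroup.Gamma0 1951 := by
    rw [CongruenceSubgroup.Gamma0_mem]; simp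
  have h := hu (-1) hmem z
  have e1 : ((-1 : Matrix.SpecialLinearGroup (Fin 2) ℤ) • z) = z := by
    rw [ModularGroup.SL_neg_smul, one_smul]
  have e2 : (((-1 : Matrix.SpecialLinearGroup (Fin 2) ℤ) 1 1 : ℤ) : ZMod 1951) = -1 := by simp
  rw [e1, e2, hodd] at h
  have : (2 : ℂ) * u z = 0 := by linear_combination h
  simpa using this

/-- **Nontriviality is load-bearing in C1.** The statement below is `QuarterFingerprintDeficit` with the
single clause `(∃ z, u z ≠ 0)` deleted (all `let`s and all other clauses verbatim), and it is FALSE: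
for the order-5 character of `exists_dirichletCharacter_orderOf_eq_five`, the zero function is
bounded, `C²` (`isC2_const`), satisfies `Δ0 + ¼·0 = 0`, is automorphic with any nebentypus, has zero
constant terms, and is a `T_p`-eigenfunction with eigenvalue `μ_p = 0`, `μ_p² χ̄(p) = 0 ∈ Φ`. [folklore] -/
theorem quarterFingerprintDeficit_false_without_nonzero :
    ¬ (let Φ : Set ℂ := {0, 1, 4, (((3 + Real.sqrt 5) / 2 : ℝ) : ℂ), (((3 - Real.sqrt 5) / 2 : ℝ) : ℂ)}
      let P₀ : Finset ℕ := {2, 3, 5, 7, 11, 13}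
      let IsForm : DirichletCharacter ℂ 1951 → (UpperHalfPlane → ℂ) → ℝ → Prop := fun χ u lam =>
        Literature.NumberTheory.Automorphic.IsC2 u ∧
        (∀ z, Literature.NumberTheory.Automorphic.hypLaplacian u z + (lam : ℂ) * u z = 0) ∧
        (∀ γ : Matrix.SpecialLinearGroup (Fin 2) ℤ, γ ∈ CongruenceSubgroup.Gamma0 1951 →
          ∀ z : UpperHalfPlane, u (γ • z) = χ ((γ 1 1 : ℤ) : ZMod 1951) * u z) ∧
        (∀ y : ℝ, 0 < y → ∫ x in (0 : ℝ)..1, u (UpperHalfPlane.ofComplex (x + y * Complex.I)) = 0) ∧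
        (∀ y : ℝ, 0 < y →
          ∫ x in (0 : ℝ)..1951, u (ModularGroup.S • UpperHalfPlane.ofComplex (x + y * Complex.I)) = 0) ∧
        (∃ C : ℝ, ∀ z, ‖u z‖ ≤ C)
      let Tp : DirichletCharacter ℂ 1951 → ℕ → (UpperHalfPlane → ℂ) → UpperHalfPlane → ℂ :=
        fun χ p u z => ((Real.sqrt p : ℝ) : ℂ)⁻¹ *
          ((∑ b ∈ Finset.range p, u (UpperHalfPlane.ofComplex (((z : ℂ) + b) / p))) +
            χ (p : ZMod 1951) * u (UpperHalfPlane.ofComplex ((p : ℂ) * z)))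
      ∀ χ : DirichletCharacter ℂ 1951, orderOf χ = 5 → ¬ ∃ (u : UpperHalfPlane → ℂ) (lam : ℝ),
        IsForm χ u lam ∧ |lam - 1 / 4| ≤ 1 / 100 ∧
        ∀ p ∈ P₀, ∃ μ φ : ℂ, φ ∈ Φ ∧ (∀ z, Tp χ p u z = μ * u z) ∧
          ‖μ ^ 2 * (starRingEnd ℂ) (χ (p : ZMod 1951)) - φ‖ ≤ 1 / 100) := by
  intro h
  obtain ⟨χ, hχ⟩ := exists_dirichletCharacter_orderOf_eq_five
  apply h χ hχ
  refine ⟨fun _ => 0, 1 / 4, ?_, by norm_num, ?_⟩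
  · exact ⟨Literature.NumberTheory.Automorphic.isC2_const 0, fun z => by simp, fun γ _ z => by simp,
      fun y _ => by simp, fun y _ => by simp, ⟨0, fun z => by simp⟩⟩
  · intro p _
    exact ⟨0, 0, by simp, fun z => by simp, by simp⟩

/-- Sanity link to the crux BY NAME: `QuarterFingerprintDeficit` is exactly the refuted variant with
the deleted clause `(∃ z, u z ≠ 0)` put back as a premise — so the two statements differ in that clause
and nothing else. [folklore] -/
theorem quarterFingerprintDeficit_iff_nonzero_restricted :
    Summit.Langlands.Langlands.Theses.QuarterDeficit1951.QuarterFingerprintDeficit ↔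
    (let Φ : Set ℂ := {0, 1, 4, (((3 + Real.sqrt 5) / 2 : ℝ) : ℂ), (((3 - Real.sqrt 5) / 2 : ℝ) : ℂ)}
      let P₀ : Finset ℕ := {2, 3, 5, 7, 11, 13}
      let IsForm : DirichletCharacter ℂ 1951 → (UpperHalfPlane → ℂ) → ℝ → Prop := fun χ u lam =>
        Literature.NumberTheory.Automorphic.IsC2 u ∧
        (∀ z, Literature.NumberTheory.Automorphic.hypLaplacian u z + (lam : ℂ) * u z = 0) ∧
        (∀ γ : Matrix.SpecialLinearGroup (Fin 2) ℤ, γ ∈ CongruenceSubgroup.Gamma0 1951 →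
          ∀ z : UpperHalfPlane, u (γ • z) = χ ((γ 1 1 : ℤ) : ZMod 1951) * u z) ∧
        (∀ y : ℝ, 0 < y → ∫ x in (0 : ℝ)..1, u (UpperHalfPlane.ofComplex (x + y * Complex.I)) = 0) ∧
        (∀ y : ℝ, 0 < y →
          ∫ x in (0 : ℝ)..1951, u (ModularGroup.S • UpperHalfPlane.ofComplex (x + y * Complex.I)) = 0) ∧
        (∃ C : ℝ, ∀ z, ‖u z‖ ≤ C)
      let Tp : DirichletCharacter ℂ 1951 → ℕ → (UpperHalfPlane → ℂ) → UpperHalfPlane → ℂ :=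
        fun χ p u z => ((Real.sqrt p : ℝ) : ℂ)⁻¹ *
          ((∑ b ∈ Finset.range p, u (UpperHalfPlane.ofComplex (((z : ℂ) + b) / p))) +
            χ (p : ZMod 1951) * u (UpperHalfPlane.ofComplex ((p : ℂ) * z)))
      ∀ χ : DirichletCharacter ℂ 1951, orderOf χ = 5 → ∀ (u : UpperHalfPlane → ℂ) (lam : ℝ),
        (∃ z, u z ≠ 0) → ¬ (IsForm χ u lam ∧ |lam - 1 / 4| ≤ 1 / 100 ∧
          ∀ p ∈ P₀, ∃ μ φ : ℂ, φ ∈ Φ ∧ (∀ z, Tp χ p u z = μ * u z) ∧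
            ‖μ ^ 2 * (starRingEnd ℂ) (χ (p : ZMod 1951)) - φ‖ ≤ 1 / 100)) := by
  refine forall₂_congr fun χ _ => ?_
  constructor
  · rintro h u lam hne ⟨hf, hl, hp⟩
    exact h ⟨u, lam, hf, hne, hl, hp⟩
  · rintro h ⟨u, lam, hf, hne, hl, hp⟩
    exact h u lam hne ⟨hf, hl, hp⟩

end Summit.Langlands.Langlands.Theorems.QuarterFingerprintDeficit.Negative

end
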